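import Summits.HodgeConjecture.HodgeConjecture.Theses.HeckePrymWeil
import Summits.HodgeConjecture.HodgeConjecture.Theses.AnchorTransport
import Summits.HodgeConjecture.HodgeConjecture.Theorems.WeilTwelvefoldsSqrtMinus7.Negative.EigenvalueTyping
import Literature.AlgebraicGeometry.Motives.AbelianVarietyProduct
import Literature.AlgebraicGeometry.Motives.AbelianVarietyProductDimProofs
import Literature.AlgebraicGeometry.Motives.PrymVariety
import Literature.AlgebraicGeometry.Motives.Jacobian
import Literature.AlgebraicGeometry.Motives.FamiliesVHS
import Literature.AlgebraicGeometry.HodgeTheory.WeilClassesFourfoldsProofs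
import Literature.AlgebraicGeometry.HodgeTheory.FermatHypersurfaceReduction
import Literature.AlgebraicGeometry.HodgeTheory.AlgebraicClassesExteriorProduct
import HarnessLib.Audit

/-!
# Line `isotypic-unimodular-saturation` — skeleton for crux `HeckePrymWeil.WeilTwelvefoldsSqrtMinus7`
(item stmt-HodgeConjecture-1261, route route-HodgeConjecture-HeckePrymWeil; crux-plan, planner
`planner-cruxplan-stmt-HodgeConjecture-1261-isotypic-unimodular--0`, 2026-08-16)

Crux (FIXED, the route's typing): on every complex abelian 12-fold `A` with `φ ≫ φ = -7` every
rational `(6,6)`-class in the typed Weil plane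
`Eig((𝟙+φ)^*, (1+i√7)¹²) ⊔ Eig((𝟙+φ)^*, (1-i√7)¹²) ⊆ H¹²(A(ℂ); ℂ)` is algebraic — all discriminants
`δ = det H ∈ ℚ^×/Nm(K^×)`, `K = ℚ(√-7)`; nothing is known in any dimension `≥ 8` for any `K`
(Markman2025SecantWeil §1.2; arXiv:2603.20268 §1; Markman ICM survey arXiv:2509.23403 §12).

Idea (crux idea card `Cruxes/WeilTwelvefoldsSqrtMinus7/Ideas/isotypic-unimodular-saturation.md`,
triage `TRIAGE-r1-{1,2,3}.md`: pass ×3).  LEVER: the route's "non-abelian Schoen problem" NS(7,3)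
(rider 1410: 88 unknown mixed monomial lines) is ONE restriction of ONE known line.  For an étale
`F₂₁ = N ⋊ μ₃`-cover `C̃ → C'` of a genus-3 curve (`g(C̃) = 43`), `σ` of order 7 generating `N`,
`τ` of order 3, `s = σ_*`, `t = τ_*` on `J = J(C̃)`, let `B := (ker Σ_{i<7} sⁱ)⁰ = Prym(C̃ → C̃/N)`
(dim 36; the tree's `AbelianVariety.kerComponent`) and `P' := (ker (𝟙_B - t_B))⁰ = (B^{μ₃})⁰`
(dim 12) with `φ' := (s + s² + s⁴ - s³ - s⁵ - s⁶)|_{P'}` (`φ'² = -7`: quadratic Gauss sum): `(P', φ')`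
is (isogenous to) the route's Hecke–Prym `P = Prym(C̃/μ₃ → C')`, of Weil type `(6,6)` for `ℚ(√-7)`.
Schoen 1988 = Patel–Zhang 2025 Thm 1.2 (étale CYCLIC cover `C̃ → C̃/N` of prime degree 7 over a
genus-7 base, `h = 12`) makes the six isotypic lines `⋀¹²(H¹(B)_{ψ^a}) ⊂ H¹²(B(ℂ); ℂ)` algebraic;
the restriction `j^*` along `j : P' ↪ B` is the `μ₃`-coinvariant map on `H¹`, so
`j^*(⋀¹²(e₁ ⊗ M_χ)) = 3⁻¹²·v¹² ⊗ det M_χ = w_σ(P')`: the typed Weil plane of `(P', φ')` is algebraic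
(NS(7,3) is a corollary; kill criterion K2 dissolves).  What is LEFT of the crux is TRANSPORT
(rider 1412) — and, per triage sharpening (b), the Hecke–Prym loci sit in ONE discriminant `δ_P`
(expected hyperbolic), so the line goes ONE RUNG UP with PRODUCT ANCHORS: `P' × B'_w`, `B'_w` a
Weil SURFACE (`E × E`, `K` by `(ι, -ι)`, polarisation weights `w = (m₁, m₂)`), whose Weil plane
`w_σ(P') ⊗ b_σ(B')` is algebraic (exterior product; `b_σ` is a divisor class) and whose discriminant
`-m₁ m₂ δ_P` runs through EVERY class: every component `𝓗_{7,δ'}` of polarised `ℚ(√-7)`-Weil 14-folds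
contains a 7-dimensional locus of Hecke–Prym-product anchors with algebraic Weil classes.  Transport
over `𝓗_{7,δ'}` (stub 4 = rider 1412 one rung up = `AnchorTransport.VariationalHodge` restricted to
these families, PROVED below to imply it) plus Schoen/Koike descent `A × B ↝ A` (stub 6 = the
pattern of route item 1263 `WeilDescending`, aimed at ONE partner surface) give the crux for every `δ`.

The six registered stubs (signatures over existing Literature / Mathlib / route declarations only;
no local definitions; the Weil planes always in the ROUTE's single-operator typing):

* `stub_schoenLines` — Schoen 1988 (Compositio 65) = Patel–Zhang arXiv:2506.13729 Thm 1.2/4.4/5.3,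
  instance `(deg, g(C̃)) = (7, 43)`: for a smooth projective curve `C` with a fixed-point-free
  automorphism `σ` of order 7 and Jacobian `𝒥` of dimension 43, on `B = (ker Σ sⁱ)⁰` every class in
  `Eig((2·𝟙_B + s_B)^*, (2 + ζ₇^a)¹²) ⊆ H¹²(B(ℂ); ℂ)`, `1 ≤ a ≤ 6`, is algebraic.  TYPING: on
  `H¹² = ⋀¹²H¹`, `(2 + s_B)^*` has eigenvalue `∏(2+ζ^{aᵢ})^{kᵢ}` on `⊗ ⋀^{kᵢ}H¹_{ψ^{aᵢ}}`; since
  `N_{ℚ(ζ₇)/ℚ}(2+ζ₇) = Φ₇(-2) = 43` is a prime `≡ 1 (7)`, the six conjugates generate six DISTINCT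
  prime ideals and `∏ 𝔭_{aᵢ}^{kᵢ} = 𝔭_a¹²` forces the pure multi-index: the eigenspace is EXACTLY the
  Schoen/PZ summand `⋀¹²(H¹(B)_{ψ^a})` of `U_Weil ⊗ ℂ` (`1 + s` would NOT separate: `(1+ζ̄)/(1+ζ) = ζ̄`).
  Size L (published theorem; vendorable as a Literature named fact + the `H^* = ⋀^*H¹` dictionary).
* `stub_heckePrymWeilPlane` — THE CARD'S LEVER with its bookkeeping (rider 1411(a)): for the full
  `F₂₁`-datum, GIVEN the six Schoen lines on `B`, the Hecke–Prym `(P', φ')` has `dim P' = 12`,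
  `φ' ≫ φ' = -7`, and its typed Weil plane `⊆ algebraicClasses` (ℂ-linear form: rationality and
  Hodge type are not needed, cf. Disproof §2 `WithoutRationality`).  Size M–L (Chevalley–Weil on real
  carriers, faithfulness of `H¹`, `j^*` = coinvariants, pull-back of `algebraicClasses` along the
  closed immersion `j` — triage Lean gap (c): Kleiman (C) for `complexBetti`, cf.
  `PulledBackAlgebraicClasses.mem_algebraicClasses_of_mem_pulledBackAlgebraicClasses`).
* `stub_productAnchor` — the product anchor is algebraic and ISOGENY-STABLE: `(X, φ_X)` a 12-fold
  and `(B', φ_{B'})` a surface, both with `φ² = -7` and algebraic typed Weil planes, `(Y, ψ)` a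
  14-fold with a `K`-equivariant isogeny pair towards `X × B'`: the typed Weil plane of `(Y, ψ)` is
  algebraic.  Künneth eigen-typing (`Eig((𝟙+φ_X×φ_{B'})^*, λ¹⁴) = ⋀¹²V_σ(X) ⊗ ⋀²V_σ(B')` by
  `Negative.EigenvalueTyping.mixed_eq_plus_iff`), `cupProduct_map_fst_map_snd_mem_algebraicClasses`,
  flat pull-back and `[m]^* = m¹⁴` (pattern `mem_algebraicClasses_of_isogeny_of_mem_weilClassesOf`).
  Size M.
* `stub_transport` — C⁺, HARDEST (open; the transferred crux = rider 1412 one rung up): the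
  VARIATIONAL HODGE statement for WEIL classes on smooth projective families of 14-folds over a
  smooth irreducible base all of whose fibres are `ℚ(√-7)`-Weil abelian 14-folds, FROM a fibre that
  is a Hecke–Prym-product anchor (up to isogeny) where the class is algebraic, in the global-class
  form of the tree (`Motives.fiberOver/fiberι`, as `HodgeTheory.Andre1996_deformation` and
  `AnchorTransport.VariationalHodge`, stmt-HodgeConjecture-1076, which implies it:
  `stub_transport_of_variationalHodge`).  Size XL / open.  No engine is supplied by the card (triage:
  "calibration anchors, not an engine"); candidate engines: semiregular/Pridham–Buchweitz–Flenner
  (`SemiregularVariationalHodge`), p-adic (`PadicSemiregularLift`), Markman secant sheaves at split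
  members (sibling cards `amnesic-secant-sheaves-split-fourteenfolds`, `subproduct-secant-sheaves`).
* `stub_reach` — moduli infrastructure (classically known, Lean XL): every Weil-type 12-fold
  `(A, φ)` (witnessed by a non-zero rational `(6,6)` Weil class) has a partner Weil surface `B` with a
  DESCENT PAIR, and `A × B` is a fibre of a smooth projective family of `ℚ(√-7)`-Weil 14-folds over a
  smooth irreducible base (the PEL/unitary Shimura family `𝓗_{7,δ(A×B)}` with neat level; Baily–Borel)
  through a Hecke–Prym-product anchor fibre (Landherr: `K`-Hermitian forms are classified by rank,
  signature and `δ`; weights of `B'` tune `δ(P'×B') = -m₁m₂δ_P` onto `δ(A × B)`; transport the lattice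
  to get an integrally equivalent `Y` isogenous to `P' × B'`; `SU(7,7)/S(U₇×U₇)` is connected), on
  which every rational `(7,7)` Weil class of `A × B` extends to a GLOBAL class that is a rational
  `(7,7)` Weil class on every fibre (monodromy acts on `⋀¹⁴_K H¹` through `det = 1`; Deligne's partie
  fixe `deligne_globalInvariantCycles`; existence of `F₂₁`-étale covers of genus-3 curves:
  `π₁(Σ₃) ↠ F₂₁`).
* `stub_descent` — Schoen 1998 §10 / Koike: descent `14 → 12` for ONE partner surface with a
  descent pair (route item 1263 `WeilDescending` is the `∀`-partner form; sibling line
  `WeilSixfoldsSqrtMinus7/Lines/hyperbolic-eightfold-descent` stub 5 is the `8 → 6` twin), including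
  the Künneth Hodge-type bookkeeping.  Size L (real Gysin `complexGysin`, projection formula,
  `components_mem_span_pair`, `one_add_I_sqrt7_pow_ne 14`).

`WeilTwelvefoldsSqrtMinus7_of` takes the six statements as hypotheses (`type_of% stub_…`) and
concludes the crux BY NAME, sorry-free: case `c = 0`; else `stub_reach` gives partner, family,
anchor; `stub_schoenLines → stub_heckePrymWeilPlane → stub_productAnchor` make the class algebraic
at the anchor fibre; `stub_transport` carries it to the fibre `≅ A × B`;
`mem_algebraicClasses_map_of_iso` moves it to `A × B`; `stub_descent` returns to `A`.

Disproof used (`Cruxes/WeilTwelvefoldsSqrtMinus7/Disproof.lean`, cycles 1–2, NO KILL; read in full):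
§2 — only `IsOfHodgeType` is load-bearing for TRUTH: honoured at `stub_reach` (the non-zero rational
`(6,6)` class witnesses Weil type; off type `(6,6)` the crux is vacuous and `_of` handles `c = 0`) and
at `stub_descent`/`stub_transport` (Hodge type carried fibrewise); `WithoutRationality` ≃ crux — stubs
2–3 are stated ℂ-linearly on purpose.  §3/§1 typing (`mixed_eq_plus_iff`, `weilEigenvalues_twelve_ne`,
`one_add_I_sqrt7_pow_ne 14`, landed `Negative/EigenvalueTyping`, imported here): the no-mixed-
coincidence lemma is exactly what stub 3's Künneth typing and stub 6's `λ ≠ λ̄` step use; the line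
uses `(𝟙+φ)^*`, never `φ^*` (`phiStar_does_not_separate`), and only `p = 7`.  §6 (`components_mem_span_pair`,
`weilComponents_conj`, landed `Negative/WeilPlaneReality`): the split/recombine toolkit of stub 6.
§8 bookkeeping (`genus_bookkeeping_7_3`, `chevalleyWeil_bookkeeping_7_3`, `prymLocus_not_dominant`) =
the arithmetic inside stubs 1–2 and the reason transport is a separate stub.  §9: the card's
`NormPullbackInjective` is PROVED there (`normPullbackInjective_holds`) — therefore NOT a stub here; the
by-product `UnimodularSaturation` is dropped (triage: optional).  `pitfall_pullback_not_additive_doc`: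
read positively — it is the lever (`(1+t+t²)^*` of a pure line is the `v¹²`-line).  No statement below
is an instance of a landed Negative lemma (those refute only the `p = 3` / `ℚ(i)` / `φ^*` typings and
single-eigenspace variants); negatives index (2026-08-16): items 11121, 12555, unrelated.
-/

noncomputable section

set_option linter.dupNamespace false

open CategoryTheory
open Literature.AlgebraicGeometry Literature.AlgebraicGeometry.Motives
  Literature.AlgebraicGeometry.HodgeTheory Literature.AlgebraicTopology.SingularHomology

namespace Summit.HodgeConjecture.HodgeConjecture.Cruxes.WeilTwelvefoldsSqrtMinus7.IsotypicUnimodularSaturation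

/-! ### The six registered stubs -/

/-- **Stub 1 — Schoen's isotypic lines (Schoen 1988 = Patel–Zhang 2025 Thm 1.2, cyclic étale cover
of prime degree 7; the instance `g(C̃) = 43`, `g(C̃/N) = 7`, `h = 12`).**  Let `C` be a smooth
projective complex curve with a fixed-point-free automorphism `σ` of order `7` and a Jacobian `𝒥`
(`Motives.Jacobian`: Albanese property) of dimension `43` (so `C → C/⟨σ⟩` is étale over a genus-7
curve); `s = σ_*` (`Jacobian.pushforward`), `e_N = Σ_{i<7} sⁱ`, `B = (ker e_N)⁰ = Prym(C → C/⟨σ⟩)`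
(`AbelianVariety.kerComponent`, dim 36; `π^* ∘ Nm = e_N` and `ker π^*` is finite), `s_B` the
restriction of `s` (it exists: `kerComponentRestrict`).  Then for `1 ≤ a ≤ 6` every class in the
eigenspace of `(2·𝟙_B + s_B)^*` on `H¹²(B(ℂ); ℂ)` for the eigenvalue `(2 + ζ₇^a)¹²`,
`ζ₇ = exp(2πi/7)`, is algebraic (lies in `N⁶H¹²`).  WHY TRUE: `H¹(B) = ⊕_{a=1}^{6} H¹_{ψ^a}`
(`Σ s_Bⁱ = 0` kills `ψ⁰`), each of dimension `2g(C/σ) - 2 = 12` (Chevalley–Weil), `H¹² = ⋀¹²H¹`, and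
`(2+s_B)^*` acts on `⊗ᵢ ⋀^{kᵢ}H¹_{ψ^{aᵢ}}` by `∏(2+ζ^{aᵢ})^{kᵢ}`; `N(2+ζ₇) = Φ₇(-2) = 43` is prime and
`≡ 1 (mod 7)`, so the conjugates `2+ζ^a` generate six distinct primes of `ℤ[ζ₇]` and the eigenvalue
`(2+ζ^a)¹²` is hit by the pure multi-index only: the eigenspace is `⋀¹²(H¹_{ψ^a})`, a summand of
`U_Weil ⊗ ℂ`, `U_Weil = ⋀¹²_{ℚ(ζ₇)}H¹(B, ℚ)`, which "consists of classes of algebraic cycles"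
(PZ Thm 1.2 p. 3, Thm 4.4 pp. 10–11: GCFT square + `ℙ⁶`-fibres of `AJ_{12}` + Kleiman's algebraic
`Λ`; Thm 5.3 p. 12 = Schoen; no genericity hypothesis, triage r1-1/r1-2 READ). [informal size L] -/
theorem stub_schoenLines :
    ∀ (C : SchemeOver ℂ) (𝒥 : Jacobian C) (σ : C ⟶ C),
      IsSmoothProjective 1 C → 𝒥.J.dim = 43 →
      σ ≫ σ ≫ σ ≫ σ ≫ σ ≫ σ ≫ σ = 𝟙 C → (∀ P : ComplexPoints C, P ≫ σ ≠ P) →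
    ∀ (s eN : 𝒥.J ⟶ 𝒥.J), s = 𝒥.pushforward 𝒥 σ →
      eN = 𝟙 𝒥.J + s + s ≫ s + s ≫ s ≫ s + s ≫ s ≫ s ≫ s + s ≫ s ≫ s ≫ s ≫ s +
        s ≫ s ≫ s ≫ s ≫ s ≫ s →
    ∀ (sB : AbelianVariety.kerComponent eN ⟶ AbelianVariety.kerComponent eN),
      sB ≫ AbelianVariety.kerComponentι eN = AbelianVariety.kerComponentι eN ≫ s →
    ∀ a : ℕ, 1 ≤ a → a ≤ 6 →
    ∀ c : complexBetti (AbelianVariety.kerComponent eN).X 12,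
      c ∈ Module.End.eigenspace
          (complexBetti.map ((2 : ℤ) • 𝟙 (AbelianVariety.kerComponent eN) + sB).hom.hom.hom 12).hom
          ((2 + Complex.exp (2 * (Real.pi : ℂ) * Complex.I / 7) ^ a) ^ 12) →
      c ∈ algebraicClasses (AbelianVariety.kerComponent eN).X 6 := by
  sorry

/-- **Stub 2 — the lever: the Hecke–Prym's typed Weil plane is ONE restriction of Schoen's lines
(card `isotypic-unimodular-saturation`; with the bookkeeping of rider 1411(a)).**  `F₂₁`-datum:
`C` smooth projective curve, `𝒥` a Jacobian of dimension `43`, automorphisms `σ` (order 7) and `τ`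
(order 3) with `σ ≫ τ = τ ≫ σ ≫ σ` (`τ σ τ⁻¹ = σ²`, `F₂₁ = ⟨σ⟩ ⋊ ⟨τ⟩`), both fixed-point free
(so the `F₂₁`-cover `C → C/F₂₁` is étale over a genus-3 curve: `84 = 21·4`); `s = σ_*`, `t = τ_*`,
`e_N = Σ sⁱ`, `B = (ker e_N)⁰` with restrictions `s_B`, `t_B` (`t e_N = e_N t` since `i ↦ 2i`
permutes `ℤ/7`), `P' = (ker(𝟙_B - t_B))⁰ = (B^{μ₃})⁰` with inclusion `j`, and `φ'` the restriction
to `P'` of the Hecke element `η_B = s_B + s_B² + s_B⁴ - s_B³ - s_B⁵ - s_B⁶` (`τ`-invariant, so it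
restricts).  IF the six Schoen lines of `(B, s_B)` are algebraic (Stub 1), THEN: `dim P' = 12`,
`φ' ≫ φ' = -7`, and EVERY class of the typed Weil plane
`Eig((𝟙+φ')^*, (1+i√7)¹²) ⊔ Eig((𝟙+φ')^*, (1-i√7)¹²) ⊆ H¹²(P'(ℂ); ℂ)` is algebraic.  WHY TRUE
(triage r1-1/2/3 re-derived it independently): irreps of `F₂₁` are `1, λ, λ̄, χ = Ind ψ ⊃ {ψ,ψ²,ψ⁴}`,
`χ̄ ⊃ {ψ³,ψ⁵,ψ⁶}`; Chevalley–Weil `H¹(C̃) = 2·1 ⊕ 4·Reg` gives `H¹(B) = χ ⊗ M ⊕ χ̄ ⊗ M̄`,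
`dim M = 12`; `η` acts on `χ ⊗ M` by the Gauss sum `ζ+ζ²+ζ⁴-ζ³-ζ⁵-ζ⁶ = i√7`, so `η_B² = -7` (`H¹`
faithful) and `φ'² = -7`; `H¹(P') = H¹(B)_{t}` (coinvariants), `dim P' = 12`; `j^* : H¹(B) → H¹(P')`
maps `e₁ ⊗ m ↦ [v]/3 ⊗ m` (`v = e₁+e₂+e₄`), so
`j^*(⋀¹²(e₁ ⊗ M)) = 3⁻¹²·v¹² ⊗ det M = ⋀¹²H¹(P')_σ = Eig((𝟙+φ')^*, (1+i√7)¹²)` (the last equality is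
`Negative.EigenvalueTyping.mixed_twelve` + `H^* = ⋀^*H¹`), and the conjugate line likewise; pull-back
of algebraic classes along the closed immersion `j` of smooth projective varieties is algebraic
(Kleiman (C) / Fulton ch. 8; Lean gap flagged by triage r1-1 (c)); `algebraicClasses` is a
ℂ-submodule.  NS(7,3) — and K2 of the route — follow. [informal size M–L] -/
theorem stub_heckePrymWeilPlane :
    ∀ (C : SchemeOver ℂ) (𝒥 : Jacobian C) (σ τ : C ⟶ C),
      IsSmoothProjective 1 C → 𝒥.J.dim = 43 →
      σ ≫ σ ≫ σ ≫ σ ≫ σ ≫ σ ≫ σ = 𝟙 C → τ ≫ τ ≫ τ = 𝟙 C → σ ≫ τ = τ ≫ σ ≫ σ →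
      (∀ P : ComplexPoints C, P ≫ σ ≠ P ∧ P ≫ τ ≠ P) →
    ∀ (s t eN : 𝒥.J ⟶ 𝒥.J), s = 𝒥.pushforward 𝒥 σ → t = 𝒥.pushforward 𝒥 τ →
      eN = 𝟙 𝒥.J + s + s ≫ s + s ≫ s ≫ s + s ≫ s ≫ s ≫ s + s ≫ s ≫ s ≫ s ≫ s +
        s ≫ s ≫ s ≫ s ≫ s ≫ s →
    ∀ (sB tB : AbelianVariety.kerComponent eN ⟶ AbelianVariety.kerComponent eN),
      sB ≫ AbelianVariety.kerComponentι eN = AbelianVariety.kerComponentι eN ≫ s →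
      tB ≫ AbelianVariety.kerComponentι eN = AbelianVariety.kerComponentι eN ≫ t →
    ∀ (φ' : AbelianVariety.kerComponent (𝟙 (AbelianVariety.kerComponent eN) - tB) ⟶
        AbelianVariety.kerComponent (𝟙 (AbelianVariety.kerComponent eN) - tB)),
      φ' ≫ AbelianVariety.kerComponentι (𝟙 (AbelianVariety.kerComponent eN) - tB) =
        AbelianVariety.kerComponentι (𝟙 (AbelianVariety.kerComponent eN) - tB) ≫
          (sB + sB ≫ sB + sB ≫ sB ≫ sB ≫ sB - sB ≫ sB ≫ sB - sB ≫ sB ≫ sB ≫ sB ≫ sB -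
            sB ≫ sB ≫ sB ≫ sB ≫ sB ≫ sB) →
    -- the six Schoen lines of `(B, s_B)` are algebraic (conclusion of Stub 1 at this datum)
    (∀ a : ℕ, 1 ≤ a → a ≤ 6 →
      ∀ c : complexBetti (AbelianVariety.kerComponent eN).X 12,
        c ∈ Module.End.eigenspace
            (complexBetti.map ((2 : ℤ) • 𝟙 (AbelianVariety.kerComponent eN) + sB).hom.hom.hom 12).hom
            ((2 + Complex.exp (2 * (Real.pi : ℂ) * Complex.I / 7) ^ a) ^ 12) →
        c ∈ algebraicClasses (AbelianVariety.kerComponent eN).X 6) →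
    (AbelianVariety.kerComponent (𝟙 (AbelianVariety.kerComponent eN) - tB)).dim = 12 ∧
    φ' ≫ φ' = -((7 : ℤ) • 𝟙 (AbelianVariety.kerComponent (𝟙 (AbelianVariety.kerComponent eN) - tB))) ∧
    ∀ c : complexBetti (AbelianVariety.kerComponent (𝟙 (AbelianVariety.kerComponent eN) - tB)).X 12,
      c ∈ Module.End.eigenspace (complexBetti.map
              (𝟙 (AbelianVariety.kerComponent (𝟙 (AbelianVariety.kerComponent eN) - tB)) + φ').hom.hom.hom
              12).hom ((1 + Complex.I * (Real.sqrt (7 : ℝ) : ℂ)) ^ 12) ⊔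
          Module.End.eigenspace (complexBetti.map
              (𝟙 (AbelianVariety.kerComponent (𝟙 (AbelianVariety.kerComponent eN) - tB)) + φ').hom.hom.hom
              12).hom ((1 - Complex.I * (Real.sqrt (7 : ℝ) : ℂ)) ^ 12) →
      c ∈ algebraicClasses (AbelianVariety.kerComponent (𝟙 (AbelianVariety.kerComponent eN) - tB)).X 6 := by
  sorry

/-- **Stub 3 — the product anchor is algebraic and isogeny-stable.**  Let `(X, φ_X)` be a complex
abelian 12-fold with `φ_X ≫ φ_X = -7` whose typed Weil plane (BOTH eigenspaces of `(𝟙+φ_X)^*` on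
`H¹²`, eigenvalues `(1±i√7)¹²`) consists of algebraic classes (Stub 2 for the Hecke–Prym), and
`(B', φ_{B'})` a complex abelian SURFACE with `φ_{B'} ≫ φ_{B'} = -7` whose typed Weil plane in `H²`
consists of algebraic classes (a Weil surface of type `(1,1)`, e.g. `E × E` with `K` acting by
`(ι, -ι)`: its Weil plane is `⟨ω₁∧ω̄₂, ω̄₁∧ω₂⟩ ⊂ H^{1,1}`, spanned by rational `(1,1)`-classes, algebraic
by Lefschetz `(1,1)`).  Let `(Y, ψ)` be a complex abelian 14-fold with `ψ ≫ ψ = -7` and an isogeny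
pair towards `X × B'`: `f : Y → X × B'` flat, `g : X × B' → Y` with `g ≫ ψ = (φ_X × φ_{B'}) ≫ g` and
`f ≫ g = m·𝟙_Y`, `m ≥ 1`.  Then every class of the typed Weil plane of `(Y, ψ)` in `H¹⁴(Y(ℂ); ℂ)`
is algebraic.  WHY TRUE: `g^*` maps `Eig((𝟙+ψ)^*, λ¹⁴)` into `Eig((𝟙+φ_X×φ_{B'})^*, λ¹⁴)`
(`λ = 1+i√7`; pattern `map_mem_weilClassesPlus_of_comm`); by Künneth, `H^* = ⋀^*H¹` and
`Negative.EigenvalueTyping.mixed_eq_plus_iff` that eigenspace is `⋀¹²V_σ(X) ⊗ ⋀²V_σ(B') =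
pr_X^* w_σ ∪ pr_{B'}^* b_σ` (the only `(a, b)` with `λᵃ·λᵇ = λ¹⁴`, `a ≤ 12`, `b ≤ 2`, no `λ̄`), an
exterior product of algebraic classes, algebraic by
`AlgebraicClassesExteriorProduct.cupProduct_map_fst_map_snd_mem_algebraicClasses`; conjugate plane
likewise; then `f^* g^* c = (m·𝟙)^* c = m¹⁴ c` is algebraic by flat pull-back
(`map_mem_algebraicClasses_of_flat`), exactly as in
`WeilClassesIsogenyDescent.mem_algebraicClasses_of_isogeny_of_mem_weilClassesOf` (there in the
multi-operator typing; here `[m]^* = m¹⁴` on `H¹⁴` must be supplied: `AbelianVarietyMulN` /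
`H^* = ⋀^*H¹`). [informal size M] -/
theorem stub_productAnchor :
    ∀ (X : AbelianVariety ℂ) (φX : X ⟶ X), X.dim = 12 → φX ≫ φX = -((7 : ℤ) • 𝟙 X) →
      (∀ c : complexBetti X.X 12,
        c ∈ Module.End.eigenspace (complexBetti.map (𝟙 X + φX).hom.hom.hom 12).hom
              ((1 + Complex.I * (Real.sqrt (7 : ℝ) : ℂ)) ^ 12) ⊔
            Module.End.eigenspace (complexBetti.map (𝟙 X + φX).hom.hom.hom 12).hom
              ((1 - Complex.I * (Real.sqrt (7 : ℝ) : ℂ)) ^ 12) →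
        c ∈ algebraicClasses X.X 6) →
    ∀ (B' : AbelianVariety ℂ) (φB' : B' ⟶ B'), B'.dim = 2 → φB' ≫ φB' = -((7 : ℤ) • 𝟙 B') →
      (∀ b : complexBetti B'.X 2,
        b ∈ Module.End.eigenspace (complexBetti.map (𝟙 B' + φB').hom.hom.hom 2).hom
              ((1 + Complex.I * (Real.sqrt (7 : ℝ) : ℂ)) ^ 2) ⊔
            Module.End.eigenspace (complexBetti.map (𝟙 B' + φB').hom.hom.hom 2).hom
              ((1 - Complex.I * (Real.sqrt (7 : ℝ) : ℂ)) ^ 2) →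
        b ∈ algebraicClasses B'.X 1) →
    ∀ (Y : AbelianVariety ℂ) (ψ : Y ⟶ Y), Y.dim = 14 → ψ ≫ ψ = -((7 : ℤ) • 𝟙 Y) →
    ∀ (f : Y ⟶ X.prod B') (g : X.prod B' ⟶ Y) (m : ℕ),
      AlgebraicGeometry.Flat f.hom.hom.hom.left → 0 < m → f ≫ g = m • 𝟙 Y →
      g ≫ ψ = AbelianVariety.prodLift (AbelianVariety.fst X B' ≫ φX) (AbelianVariety.snd X B' ≫ φB') ≫ g →
    ∀ c : complexBetti Y.X 14,
      c ∈ Module.End.eigenspace (complexBetti.map (𝟙 Y + ψ).hom.hom.hom 14).hom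
            ((1 + Complex.I * (Real.sqrt (7 : ℝ) : ℂ)) ^ 14) ⊔
          Module.End.eigenspace (complexBetti.map (𝟙 Y + ψ).hom.hom.hom 14).hom
            ((1 - Complex.I * (Real.sqrt (7 : ℝ) : ℂ)) ^ 14) →
      c ∈ algebraicClasses Y.X 7 := by
  sorry

/-- **Stub 4 — C⁺, TRANSPORT (hardest; the transferred crux = rider 1412 `HeckePrymTransport` one rung
up, in the tree's global-class form).**  Let `f : 𝒳 ⟶ S` be a smooth projective family of relative
dimension `14` over a smooth irreducible `ℂ`-scheme (as in `AnchorTransport.VariationalHodge`), all of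
whose fibres are `ℚ(√-7)`-Weil abelian 14-folds in the sense that a global class
`A ∈ H¹⁴(𝒳(ℂ); ℂ)` restricts on EVERY fibre `𝒳_s ≅ Y_s` to a rational `(7,7)`-class lying in the
typed Weil plane of some `(Y_s, ψ_s)`, `ψ_s² = -7`.  Suppose ONE fibre `𝒳_{s₀} ≅ Y` is a
HECKE–PRYM-PRODUCT ANCHOR — `(Y, ψ)` carries an isogeny pair towards `P' × B'`, `P'` the Hecke–Prym of
an `F₂₁`-curve datum (Stub 2's object, spelled out) and `B'` a Weil surface — on which `A|_{𝒳_{s₀}}`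
is a Weil class AND algebraic (Stubs 1–3).  Then `A|_{𝒳_s}` is algebraic for every `s`.  This is the
variational Hodge conjecture (Grothendieck 1966; Charles–Schnell Conj. 11.3.1) for these families —
`stub_transport_of_variationalHodge` below derives it from `AnchorTransport.VariationalHodge`
(stmt-1076) — and it is implied by the Hodge conjecture (André: Weil classes are motivated, so it is
irrefutable here).  In the universal family over `𝓗_{7,δ}` the anchor fibres form a 7-dimensional
locus `{P'_t × B'_w}` (`prymLocus_not_dominant`: codimension 42), on ALL of which Stubs 1–3 give
algebraicity; the Schoen/PZ cycles are curve-built, hence NOT semiregular off the locus (sibling card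
F1: AJ curves semiregular iff `g ≤ 3`): they CALIBRATE an engine, they are not its input.  No engine
is claimed. [informal size XL; open] -/
theorem stub_transport :
    ∀ ⦃𝒳 S : SchemeOver ℂ⦄ (f : 𝒳 ⟶ S), IsSmoothProjectiveFamily f 14 →
      IrreducibleSpace S.left → AlgebraicGeometry.Smooth S.hom →
    ∀ (A : complexBetti 𝒳 14),
      (∀ s : ComplexPoints S,
        IsRationalClass (complexBetti.map (fiberι f s) 14 A) ∧
        IsOfHodgeType 14 (fiberOver f s) 14 7 7 (complexBetti.map (fiberι f s) 14 A)) →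
      -- every fibre is a Weil-type abelian 14-fold on which `A` restricts into the typed Weil plane
      (∀ s : ComplexPoints S, ∃ (Ys : AbelianVariety ℂ) (ψs : Ys ⟶ Ys) (es : Ys.X ≅ fiberOver f s),
        Ys.dim = 14 ∧ ψs ≫ ψs = -((7 : ℤ) • 𝟙 Ys) ∧
        complexBetti.map es.hom 14 (complexBetti.map (fiberι f s) 14 A) ∈
          Module.End.eigenspace (complexBetti.map (𝟙 Ys + ψs).hom.hom.hom 14).hom
              ((1 + Complex.I * (Real.sqrt (7 : ℝ) : ℂ)) ^ 14) ⊔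
            Module.End.eigenspace (complexBetti.map (𝟙 Ys + ψs).hom.hom.hom 14).hom
              ((1 - Complex.I * (Real.sqrt (7 : ℝ) : ℂ)) ^ 14)) →
      -- ONE fibre is a Hecke–Prym-product anchor (up to isogeny) on which `A` is an ALGEBRAIC Weil class
      (∃ (s₀ : ComplexPoints S) (Y : AbelianVariety ℂ) (ψ : Y ⟶ Y) (e : Y.X ≅ fiberOver f s₀),
        Y.dim = 14 ∧ ψ ≫ ψ = -((7 : ℤ) • 𝟙 Y) ∧
        (∃ (C : SchemeOver ℂ) (𝒥 : Jacobian C) (σ τ : C ⟶ C) (s t eN : 𝒥.J ⟶ 𝒥.J)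
            (sB tB : AbelianVariety.kerComponent eN ⟶ AbelianVariety.kerComponent eN)
            (φ' : AbelianVariety.kerComponent (𝟙 (AbelianVariety.kerComponent eN) - tB) ⟶
              AbelianVariety.kerComponent (𝟙 (AbelianVariety.kerComponent eN) - tB))
            (B' : AbelianVariety ℂ) (φB' : B' ⟶ B')
            (fY : Y ⟶ (AbelianVariety.kerComponent (𝟙 (AbelianVariety.kerComponent eN) - tB)).prod B')
            (gY : (AbelianVariety.kerComponent (𝟙 (AbelianVariety.kerComponent eN) - tB)).prod B' ⟶ Y)
            (m : ℕ),
          IsSmoothProjective 1 C ∧ 𝒥.J.dim = 43 ∧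
          σ ≫ σ ≫ σ ≫ σ ≫ σ ≫ σ ≫ σ = 𝟙 C ∧ τ ≫ τ ≫ τ = 𝟙 C ∧ σ ≫ τ = τ ≫ σ ≫ σ ∧
          (∀ P : ComplexPoints C, P ≫ σ ≠ P ∧ P ≫ τ ≠ P) ∧
          s = 𝒥.pushforward 𝒥 σ ∧ t = 𝒥.pushforward 𝒥 τ ∧
          eN = 𝟙 𝒥.J + s + s ≫ s + s ≫ s ≫ s + s ≫ s ≫ s ≫ s + s ≫ s ≫ s ≫ s ≫ s +
            s ≫ s ≫ s ≫ s ≫ s ≫ s ∧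
          sB ≫ AbelianVariety.kerComponentι eN = AbelianVariety.kerComponentι eN ≫ s ∧
          tB ≫ AbelianVariety.kerComponentι eN = AbelianVariety.kerComponentι eN ≫ t ∧
          φ' ≫ AbelianVariety.kerComponentι (𝟙 (AbelianVariety.kerComponent eN) - tB) =
            AbelianVariety.kerComponentι (𝟙 (AbelianVariety.kerComponent eN) - tB) ≫
              (sB + sB ≫ sB + sB ≫ sB ≫ sB ≫ sB - sB ≫ sB ≫ sB - sB ≫ sB ≫ sB ≫ sB ≫ sB -
                sB ≫ sB ≫ sB ≫ sB ≫ sB ≫ sB) ∧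
          B'.dim = 2 ∧ φB' ≫ φB' = -((7 : ℤ) • 𝟙 B') ∧
          (∀ b : complexBetti B'.X 2,
            b ∈ Module.End.eigenspace (complexBetti.map (𝟙 B' + φB').hom.hom.hom 2).hom
                  ((1 + Complex.I * (Real.sqrt (7 : ℝ) : ℂ)) ^ 2) ⊔
                Module.End.eigenspace (complexBetti.map (𝟙 B' + φB').hom.hom.hom 2).hom
                  ((1 - Complex.I * (Real.sqrt (7 : ℝ) : ℂ)) ^ 2) →
            b ∈ algebraicClasses B'.X 1) ∧
          AlgebraicGeometry.Flat fY.hom.hom.hom.left ∧ 0 < m ∧ fY ≫ gY = m • 𝟙 Y ∧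
          gY ≫ ψ = AbelianVariety.prodLift
            (AbelianVariety.fst (AbelianVariety.kerComponent (𝟙 (AbelianVariety.kerComponent eN) - tB)) B' ≫ φ')
            (AbelianVariety.snd (AbelianVariety.kerComponent (𝟙 (AbelianVariety.kerComponent eN) - tB)) B' ≫ φB') ≫
            gY) ∧
        complexBetti.map e.hom 14 (complexBetti.map (fiberι f s₀) 14 A) ∈
          Module.End.eigenspace (complexBetti.map (𝟙 Y + ψ).hom.hom.hom 14).hom
              ((1 + Complex.I * (Real.sqrt (7 : ℝ) : ℂ)) ^ 14) ⊔
            Module.End.eigenspace (complexBetti.map (𝟙 Y + ψ).hom.hom.hom 14).hom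
              ((1 - Complex.I * (Real.sqrt (7 : ℝ) : ℂ)) ^ 14) ∧
        complexBetti.map e.hom 14 (complexBetti.map (fiberι f s₀) 14 A) ∈ algebraicClasses Y.X 7) →
    ∀ s : ComplexPoints S,
      complexBetti.map (fiberι f s) 14 A ∈ algebraicClasses (fiberOver f s) 7 := by
  sorry

/-- **Stub 5 — REACH: partner surface + family through a Hecke–Prym-product anchor (moduli
infrastructure; classically known).**  For a complex abelian 12-fold `(A, φ)`, `φ ≫ φ = -7`, of Weil
type `(6,6)` — witnessed, as the crux supplies it, by a NON-ZERO rational `(6,6)`-class in its typed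
Weil plane — there exist: (i) a complex abelian surface `(B, φ_B)`, `φ_B ≫ φ_B = -7`, with a DESCENT
PAIR `b± ∈ Eig((𝟙+φ_B)^*, (1±i√7)²)`, `b₊ + b₋` rational `(1,1)`, and an algebraic `η ∈ N¹H²(B)` with
`b± ∪ η ≠ 0` (intended: `B = E × E`, `E = ℂ/ℤ[(1+√-7)/2]`, `φ_B = (ι, -ι)`; `b₊ = ω₁ ∧ ω̄₂`,
`η = b₊ + b₋`, rational of type `(1,1)` hence a divisor class, `b₊ ∪ η = b₊ ∪ b₋ ≠ 0`; NB a product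
ample class `h₁ + h₂` has `b± ∪ h = 0`); (ii) a smooth projective family `f : 𝒳 ⟶ S` of relative
dimension `14` over a smooth irreducible `ℂ`-scheme with a fibre `𝒳_{s₁} ≅ A × B`; such that
(iii) every rational `(7,7)`-class `u` of the typed Weil plane of `(A × B, φ × φ_B)` is the restriction
of a GLOBAL class `𝒰 ∈ H¹⁴(𝒳(ℂ); ℂ)` which on every fibre is a rational `(7,7)` Weil class of a
`ℚ(√-7)`-Weil abelian 14-fold `≅ 𝒳_s`, and which at SOME fibre `𝒳_{s₀} ≅ Y` is a Weil class of a
Hecke–Prym-product anchor `(Y, ψ)` (isogeny pair towards `P' × B'`, `P'` the Hecke–Prym of an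
`F₂₁`-curve datum as in Stub 2, `B'` a Weil surface with algebraic typed Weil plane).  WHY TRUE:
`S` = a neat-level cover of the PEL (unitary) Shimura component `𝓗_{7,δ(A×B)}` with its universal
abelian scheme (smooth, quasi-projective by Baily–Borel, IRREDUCIBLE: `SU(7,7)/S(U₇×U₇)` is connected),
which has `A × B` as a fibre; `F₂₁`-étale covers of genus-3 curves exist (`π₁(Σ₃) ↠ F₂₁`: `a₁ ↦ σ`,
`a₂ ↦ τ`, rest `↦ 1`), giving `P'` (Stub 2) of discriminant `δ_P`; the weights `(m₁, m₂)` of the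
product polarisation on `B' = E × E` give `δ(P' × B') = -m₁m₂δ_P`, which exhausts `ℚ^×/Nm(K^×)` in
the admissible sign, so for suitable weights `(P' × B') ⊗ ℚ ≅ (A × B) ⊗ ℚ` as polarised Hermitian
`K`-spaces (Landherr: rank, signature, `δ` classify); transporting the lattice of `A × B` along this
isometry yields `Y`, `K`-isogenous to `P' × B'` and INTEGRALLY equivalent to `A × B`, hence a fibre
`𝒳_{s₀}` of the same family; the Weil plane `⋀¹⁴_K H¹` is a rank-2 sub-local system on which the
monodromy `Γ ⊂ SU(H)` acts through `det = 1`, so every `u` extends to a flat global section, which is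
the restriction of a RATIONAL class of a smooth compactification (Deligne, Hodge II 4.1.1 =
`deligne_globalInvariantCycles`; `ℚ`-coefficients), whose restrictions stay in the flat Weil
sub-bundle (hence rational, `(7,7)`, Weil on every fibre).  The crux's `IsOfHodgeType` hypothesis is
used HERE (Disproof §2: the one load-bearing hypothesis): without Weil type `(6,6)` nothing places
`A` in `𝓗_{6,·}`. [informal size: classically two pages; Lean XL — PEL families, Baily–Borel, CM
curve with `ι`, lattices] -/
theorem stub_reach :
    ∀ (A : AbelianVariety ℂ) (φ : A ⟶ A), A.dim = 12 → φ ≫ φ = -((7 : ℤ) • 𝟙 A) →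
    (∃ c : complexBetti A.X 12, c ≠ 0 ∧ IsRationalClass c ∧ IsOfHodgeType 12 A.X 12 6 6 c ∧
      c ∈ Module.End.eigenspace (complexBetti.map (𝟙 A + φ).hom.hom.hom 12).hom
            ((1 + Complex.I * (Real.sqrt (7 : ℝ) : ℂ)) ^ 12) ⊔
          Module.End.eigenspace (complexBetti.map (𝟙 A + φ).hom.hom.hom 12).hom
            ((1 - Complex.I * (Real.sqrt (7 : ℝ) : ℂ)) ^ 12)) →
    ∃ (B : AbelianVariety ℂ) (φB : B ⟶ B), B.dim = 2 ∧ φB ≫ φB = -((7 : ℤ) • 𝟙 B) ∧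
      (∃ bp bm η : complexBetti B.X 2,
        bp ∈ Module.End.eigenspace (complexBetti.map (𝟙 B + φB).hom.hom.hom 2).hom
              ((1 + Complex.I * (Real.sqrt (7 : ℝ) : ℂ)) ^ 2) ∧
        bm ∈ Module.End.eigenspace (complexBetti.map (𝟙 B + φB).hom.hom.hom 2).hom
              ((1 - Complex.I * (Real.sqrt (7 : ℝ) : ℂ)) ^ 2) ∧
        IsRationalClass (bp + bm) ∧ IsOfHodgeType 2 B.X 2 1 1 (bp + bm) ∧
        η ∈ algebraicClasses B.X 1 ∧
        cupProduct (show 2 + 2 = 4 from rfl) bp η ≠ 0 ∧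
        cupProduct (show 2 + 2 = 4 from rfl) bm η ≠ 0) ∧
      ∃ (𝒳 S : SchemeOver ℂ) (f : 𝒳 ⟶ S),
        IsSmoothProjectiveFamily f 14 ∧ IrreducibleSpace S.left ∧ AlgebraicGeometry.Smooth S.hom ∧
        ∃ (s₁ : ComplexPoints S) (e₁ : (A.prod B).X ≅ fiberOver f s₁),
          ∀ u : complexBetti (A.prod B).X 14, IsRationalClass u →
            IsOfHodgeType 14 (A.prod B).X 14 7 7 u →
            u ∈ Module.End.eigenspace (complexBetti.map (𝟙 (A.prod B) +
                    AbelianVariety.prodLift (AbelianVariety.fst A B ≫ φ) (AbelianVariety.snd A B ≫ φB)).hom.hom.hom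
                    14).hom ((1 + Complex.I * (Real.sqrt (7 : ℝ) : ℂ)) ^ 14) ⊔
                Module.End.eigenspace (complexBetti.map (𝟙 (A.prod B) +
                    AbelianVariety.prodLift (AbelianVariety.fst A B ≫ φ) (AbelianVariety.snd A B ≫ φB)).hom.hom.hom
                    14).hom ((1 - Complex.I * (Real.sqrt (7 : ℝ) : ℂ)) ^ 14) →
            ∃ 𝒰 : complexBetti 𝒳 14,
              complexBetti.map e₁.hom 14 (complexBetti.map (fiberι f s₁) 14 𝒰) = u ∧
              (∀ s : ComplexPoints S,
                IsRationalClass (complexBetti.map (fiberι f s) 14 𝒰) ∧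
                IsOfHodgeType 14 (fiberOver f s) 14 7 7 (complexBetti.map (fiberι f s) 14 𝒰)) ∧
              (∀ s : ComplexPoints S, ∃ (Ys : AbelianVariety ℂ) (ψs : Ys ⟶ Ys) (es : Ys.X ≅ fiberOver f s),
                Ys.dim = 14 ∧ ψs ≫ ψs = -((7 : ℤ) • 𝟙 Ys) ∧
                complexBetti.map es.hom 14 (complexBetti.map (fiberι f s) 14 𝒰) ∈
                  Module.End.eigenspace (complexBetti.map (𝟙 Ys + ψs).hom.hom.hom 14).hom
                      ((1 + Complex.I * (Real.sqrt (7 : ℝ) : ℂ)) ^ 14) ⊔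
                    Module.End.eigenspace (complexBetti.map (𝟙 Ys + ψs).hom.hom.hom 14).hom
                      ((1 - Complex.I * (Real.sqrt (7 : ℝ) : ℂ)) ^ 14)) ∧
              ∃ (s₀ : ComplexPoints S) (Y : AbelianVariety ℂ) (ψ : Y ⟶ Y) (e : Y.X ≅ fiberOver f s₀),
                Y.dim = 14 ∧ ψ ≫ ψ = -((7 : ℤ) • 𝟙 Y) ∧
                (∃ (C : SchemeOver ℂ) (𝒥 : Jacobian C) (σ τ : C ⟶ C) (s t eN : 𝒥.J ⟶ 𝒥.J)
                    (sB tB : AbelianVariety.kerComponent eN ⟶ AbelianVariety.kerComponent eN)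
                    (φ' : AbelianVariety.kerComponent (𝟙 (AbelianVariety.kerComponent eN) - tB) ⟶
                      AbelianVariety.kerComponent (𝟙 (AbelianVariety.kerComponent eN) - tB))
                    (B' : AbelianVariety ℂ) (φB' : B' ⟶ B')
                    (fY : Y ⟶ (AbelianVariety.kerComponent (𝟙 (AbelianVariety.kerComponent eN) - tB)).prod B')
                    (gY : (AbelianVariety.kerComponent (𝟙 (AbelianVariety.kerComponent eN) - tB)).prod B' ⟶ Y)
                    (m : ℕ),
                  IsSmoothProjective 1 C ∧ 𝒥.J.dim = 43 ∧
                  σ ≫ σ ≫ σ ≫ σ ≫ σ ≫ σ ≫ σ = 𝟙 C ∧ τ ≫ τ ≫ τ = 𝟙 C ∧ σ ≫ τ = τ ≫ σ ≫ σ ∧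
                  (∀ P : ComplexPoints C, P ≫ σ ≠ P ∧ P ≫ τ ≠ P) ∧
                  s = 𝒥.pushforward 𝒥 σ ∧ t = 𝒥.pushforward 𝒥 τ ∧
                  eN = 𝟙 𝒥.J + s + s ≫ s + s ≫ s ≫ s + s ≫ s ≫ s ≫ s + s ≫ s ≫ s ≫ s ≫ s +
                    s ≫ s ≫ s ≫ s ≫ s ≫ s ∧
                  sB ≫ AbelianVariety.kerComponentι eN = AbelianVariety.kerComponentι eN ≫ s ∧
                  tB ≫ AbelianVariety.kerComponentι eN = AbelianVariety.kerComponentι eN ≫ t ∧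
                  φ' ≫ AbelianVariety.kerComponentι (𝟙 (AbelianVariety.kerComponent eN) - tB) =
                    AbelianVariety.kerComponentι (𝟙 (AbelianVariety.kerComponent eN) - tB) ≫
                      (sB + sB ≫ sB + sB ≫ sB ≫ sB ≫ sB - sB ≫ sB ≫ sB - sB ≫ sB ≫ sB ≫ sB ≫ sB -
                        sB ≫ sB ≫ sB ≫ sB ≫ sB ≫ sB) ∧
                  B'.dim = 2 ∧ φB' ≫ φB' = -((7 : ℤ) • 𝟙 B') ∧
                  (∀ b : complexBetti B'.X 2,
                    b ∈ Module.End.eigenspace (complexBetti.map (𝟙 B' + φB').hom.hom.hom 2).hom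
                          ((1 + Complex.I * (Real.sqrt (7 : ℝ) : ℂ)) ^ 2) ⊔
                        Module.End.eigenspace (complexBetti.map (𝟙 B' + φB').hom.hom.hom 2).hom
                          ((1 - Complex.I * (Real.sqrt (7 : ℝ) : ℂ)) ^ 2) →
                    b ∈ algebraicClasses B'.X 1) ∧
                  AlgebraicGeometry.Flat fY.hom.hom.hom.left ∧ 0 < m ∧ fY ≫ gY = m • 𝟙 Y ∧
                  gY ≫ ψ = AbelianVariety.prodLift
                    (AbelianVariety.fst (AbelianVariety.kerComponent (𝟙 (AbelianVariety.kerComponent eN) - tB)) B' ≫ φ')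
                    (AbelianVariety.snd (AbelianVariety.kerComponent (𝟙 (AbelianVariety.kerComponent eN) - tB)) B' ≫ φB') ≫
                    gY) ∧
                complexBetti.map e.hom 14 (complexBetti.map (fiberι f s₀) 14 𝒰) ∈
                  Module.End.eigenspace (complexBetti.map (𝟙 Y + ψ).hom.hom.hom 14).hom
                      ((1 + Complex.I * (Real.sqrt (7 : ℝ) : ℂ)) ^ 14) ⊔
                    Module.End.eigenspace (complexBetti.map (𝟙 Y + ψ).hom.hom.hom 14).hom
                      ((1 - Complex.I * (Real.sqrt (7 : ℝ) : ℂ)) ^ 14) := by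
  sorry

/-- **Stub 6 — Schoen/Koike descent `14 → 12` for ONE partner surface with a descent pair**
(Schoen 1998 §10; Koike doi:10.4153/cmb-2004-055-x; Markman2025SurveySecant §11.5 Step 2; the
route's support item 1263 `WeilDescending` is the `∀`-partner form; twin of stub 5 of the sibling line
`WeilSixfoldsSqrtMinus7/Lines/hyperbolic-eightfold-descent` one rung up).  Let `(A, φ)` be a complex
abelian 12-fold and `(B, φ_B)` a complex abelian surface, `φ² = φ_B² = -7`, `B` carrying a descent pair
`(b₊, b₋, η)` as in Stub 5, `ψ = φ × φ_B` on `A × B`.  IF every rational `(7,7)`-class of the typed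
Weil plane `Eig((𝟙+ψ)^*, (1+i√7)¹⁴) ⊔ Eig((𝟙+ψ)^*, (1-i√7)¹⁴)` of `A × B` is algebraic, THEN every
rational `(6,6)`-class `c = c₊ + c₋` of the typed Weil plane of `A` is algebraic.  Proof:
`P = pr_A^* c ∪ pr_B^* (b₊ + b₋)` is rational (`isRationalClass_cupProduct_map_fst_map_snd`) and
`(7,7)` (Künneth for Hodge models: Voisin I Thm 11.38 — included in this stub's burden; cf. sibling
`stub_hodgeTypeExterior`); with `T = (𝟙+ψ)^*` (`(𝟙+ψ) ≫ pr_A = pr_A ≫ (𝟙+φ)`) its four pieces have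
eigenvalues `λ₊¹⁴, λ₋¹⁴, λ₊¹²λ₋², λ₋¹²λ₊²`, pairwise distinct (`λ₊/λ₋` no root of unity:
`Negative.EigenvalueTyping.one_add_I_sqrt7_pow_ne`), so `q(T)P` and `T q(T) P`
(`q = (X - λ₊¹²λ₋²)(X - λ₋¹²λ₊²) ∈ ℤ[X]`) are rational `(7,7)` Weil classes of `A × B`, hence
algebraic, hence so are `P₊₊ = pr_A^* c₊ ∪ pr_B^* b₊` and `P₋₋` (`components_mem_span_pair`,
landed `Negative/WeilPlaneReality`); `P±± ∪ pr_B^* η ∈ N⁸H¹⁶` (cup with the flat pull-back of a divisor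
class moved by a translation of `B`); `pr_{A*}(P±± ∪ pr_B^* η) = ε± · c±` with `ε± ≠ 0` because
`b± ∪ η ≠ 0` spans `H⁴(B(ℂ); ℂ) ≅ ℂ` (real Gysin `complexGysin` + Poincaré duality, projection formula
`complexGysin_cup`, Gysin preserves `N^•`: `gysinMap_mem_supportedClasses_of_isSmoothProjective`), so
`c±`, hence `c`, are algebraic. [informal size L] -/
theorem stub_descent :
    ∀ (A : AbelianVariety ℂ) (φ : A ⟶ A) (B : AbelianVariety ℂ) (φB : B ⟶ B),
      A.dim = 12 → B.dim = 2 → φ ≫ φ = -((7 : ℤ) • 𝟙 A) → φB ≫ φB = -((7 : ℤ) • 𝟙 B) →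
      (∃ bp bm η : complexBetti B.X 2,
        bp ∈ Module.End.eigenspace (complexBetti.map (𝟙 B + φB).hom.hom.hom 2).hom
              ((1 + Complex.I * (Real.sqrt (7 : ℝ) : ℂ)) ^ 2) ∧
        bm ∈ Module.End.eigenspace (complexBetti.map (𝟙 B + φB).hom.hom.hom 2).hom
              ((1 - Complex.I * (Real.sqrt (7 : ℝ) : ℂ)) ^ 2) ∧
        IsRationalClass (bp + bm) ∧ IsOfHodgeType 2 B.X 2 1 1 (bp + bm) ∧
        η ∈ algebraicClasses B.X 1 ∧
        cupProduct (show 2 + 2 = 4 from rfl) bp η ≠ 0 ∧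
        cupProduct (show 2 + 2 = 4 from rfl) bm η ≠ 0) →
      (∀ u : complexBetti (A.prod B).X 14, IsRationalClass u → IsOfHodgeType 14 (A.prod B).X 14 7 7 u →
        u ∈ Module.End.eigenspace (complexBetti.map (𝟙 (A.prod B) +
                AbelianVariety.prodLift (AbelianVariety.fst A B ≫ φ) (AbelianVariety.snd A B ≫ φB)).hom.hom.hom
                14).hom ((1 + Complex.I * (Real.sqrt (7 : ℝ) : ℂ)) ^ 14) ⊔
            Module.End.eigenspace (complexBetti.map (𝟙 (A.prod B) +
                AbelianVariety.prodLift (AbelianVariety.fst A B ≫ φ) (AbelianVariety.snd A B ≫ φB)).hom.hom.hom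
                14).hom ((1 - Complex.I * (Real.sqrt (7 : ℝ) : ℂ)) ^ 14) →
        u ∈ algebraicClasses (A.prod B).X 7) →
      ∀ c : complexBetti A.X 12, IsRationalClass c → IsOfHodgeType 12 A.X 12 6 6 c →
        c ∈ Module.End.eigenspace (complexBetti.map (𝟙 A + φ).hom.hom.hom 12).hom
              ((1 + Complex.I * (Real.sqrt (7 : ℝ) : ℂ)) ^ 12) ⊔
            Module.End.eigenspace (complexBetti.map (𝟙 A + φ).hom.hom.hom 12).hom
              ((1 - Complex.I * (Real.sqrt (7 : ℝ) : ℂ)) ^ 12) →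
        c ∈ algebraicClasses A.X 6 := by
  sorry

/-! ### The composition (concludes the crux BY NAME; sorry-free glue) -/

/-- **`WeilTwelvefoldsSqrtMinus7` from the six stubs.**  Given a 12-fold `(A, φ)` and a rational
`(6,6)` Weil class `c`: if `c = 0` it is algebraic; otherwise `c` witnesses Weil type, Stub 5 yields
the partner surface `B` with its descent pair, the family `f : 𝒳 ⟶ S` with `𝒳_{s₁} ≅ A × B` and the
extension/anchor property; Stub 6 reduces to the rational `(7,7)` Weil classes `u` of `A × B`; for
such `u` Stub 5 gives the global class `𝒰` and the anchor fibre `𝒳_{s₀} ≅ Y`, `Y` isogenous to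
`P' × B'`; Stub 1 (Schoen lines on `B_N`) feeds Stub 2 (typed Weil plane of `P'` algebraic, `dim 12`,
`φ'² = -7`), which with Stub 3 makes `𝒰|_{s₀}` algebraic on `Y`; Stub 4 transports to `s₁`;
`mem_algebraicClasses_map_of_iso` (along `e₁ : A × B ≅ 𝒳_{s₁}`) gives `u` algebraic. -/
theorem WeilTwelvefoldsSqrtMinus7_of
    (h₁ : type_of% stub_schoenLines) (h₂ : type_of% stub_heckePrymWeilPlane)
    (h₃ : type_of% stub_productAnchor) (h₄ : type_of% stub_transport)
    (h₅ : type_of% stub_reach) (h₆ : type_of% stub_descent) :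
    Summit.HodgeConjecture.HodgeConjecture.Theses.HeckePrymWeil.WeilTwelvefoldsSqrtMinus7 := by
  intro A φ hA hφ c hrat hH hW
  by_cases hc : c = 0
  · rw [hc]
    exact Submodule.zero_mem _
  obtain ⟨B, φB, hB, hφB, hpair, 𝒳, S, f, hf, hirr, hsm, s₁, e₁, hext⟩ :=
    h₅ A φ hA hφ ⟨c, hc, hrat, hH, hW⟩
  refine h₆ A φ B φB hA hB hφ hφB hpair ?_ c hrat hH hW
  intro u hu huH huW
  obtain ⟨𝒰, hu𝒰, hall, hweil, s₀, Y, ψ, e, hY, hψ, hdatum, hplane⟩ := hext u hu huH huW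
  obtain ⟨C, 𝒥, σ, τ, s, t, eN, sB, tB, φ', B', φB', fY, gY, m, hC, hg, hσ7, hτ3, hrel, hfree,
    hs, ht, heN, hsB, htB, hφ', hB', hφB', hB'alg, hflat, hm, hfg, hgψ⟩ := hdatum
  -- Schoen's lines on `B_N` (Stub 1), the Hecke–Prym's Weil plane (Stub 2), the anchor (Stub 3)
  have hS := h₁ C 𝒥 σ hC hg hσ7 (fun P => (hfree P).1) s eN hs heN sB hsB
  obtain ⟨hPdim, hφ'sq, hPalg⟩ :=
    h₂ C 𝒥 σ τ hC hg hσ7 hτ3 hrel hfree s t eN hs ht heN sB tB hsB htB φ' hφ' hS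
  have hYalg := h₃ _ φ' hPdim hφ'sq hPalg B' φB' hB' hφB' hB'alg Y ψ hY hψ fY gY m hflat hm hfg hgψ
  -- transport to the fibre over `s₁` (Stub 4)
  have h𝒰 : complexBetti.map (fiberι f s₁) 14 𝒰 ∈ algebraicClasses (fiberOver f s₁) 7 :=
    h₄ f hf hirr hsm 𝒰 hall hweil
      ⟨s₀, Y, ψ, e, hY, hψ,
        ⟨C, 𝒥, σ, τ, s, t, eN, sB, tB, φ', B', φB', fY, gY, m, hC, hg, hσ7, hτ3, hrel, hfree,
          hs, ht, heN, hsB, htB, hφ', hB', hφB', hB'alg, hflat, hm, hfg, hgψ⟩,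
        hplane, hYalg _ hplane⟩ s₁
  -- move along the isomorphism `e₁ : A × B ≅ 𝒳_{s₁}`
  have key := mem_algebraicClasses_map_of_iso (p := 7) (hf.isSmoothProjective s₁)
    (AbelianVariety.isSmoothProjective_holds (A := A.prod B)) e₁ h𝒰
  rw [hu𝒰] at key
  exact key

/-- The crux from the stubs as they stand (depends on their `sorry`s; shows the composition closes). -/
theorem WeilTwelvefoldsSqrtMinus7_of_stubs :
    Summit.HodgeConjecture.HodgeConjecture.Theses.HeckePrymWeil.WeilTwelvefoldsSqrtMinus7 :=
  WeilTwelvefoldsSqrtMinus7_of stub_schoenLines stub_heckePrymWeilPlane stub_productAnchor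
    stub_transport stub_reach stub_descent

/-! ### Certified cross-links (sorry-free) -/

/-- **Stub 4 is an instance of `AnchorTransport.VariationalHodge`** (route AnchorTransport, item
stmt-HodgeConjecture-1076, the shared transport engine named by rider 1412): the variational Hodge
conjecture in global-class form implies the Hecke–Prym-anchored transport (forget the anchor
structure, keep "algebraic at `s₀`"). -/
theorem stub_transport_of_variationalHodge
    (hV : Summit.HodgeConjecture.HodgeConjecture.Theses.AnchorTransport.VariationalHodge) :
    type_of% stub_transport := by
  intro 𝒳 S f hf hirr hsm A hall _ hanchor s
  obtain ⟨s₀, Y, ψ, e, -, -, -, -, halg⟩ := hanchor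
  refine hV f hf hirr hsm 7 A hall ⟨s₀, ?_⟩ s
  -- `e^*` is injective-compatible: pull back along `e.inv` to return to the fibre
  have key := mem_algebraicClasses_map_of_iso (p := 7)
    (AbelianVariety.isSmoothProjective_holds (A := Y)) (hf.isSmoothProjective s₀) e.symm halg
  have hid : complexBetti.map e.symm.hom 14 (complexBetti.map e.hom 14
      (complexBetti.map (fiberι f s₀) 14 A)) = complexBetti.map (fiberι f s₀) 14 A := by
    rw [← CategoryTheory.comp_apply, ← complexBetti.map_comp, Iso.symm_hom, Iso.inv_hom_id,
      complexBetti.map_id]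
    rfl
  rw [hid] at key
  exact key

end Summit.HodgeConjecture.HodgeConjecture.Cruxes.WeilTwelvefoldsSqrtMinus7.IsotypicUnimodularSaturation
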